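import Literature.MathematicalPhysics.QuantumFieldTheory.Balaban1983to89.Setup

/-!
# `Balaban1983to89.B15.PrelimIntegrations` — B15 §1, pp. 178–199: the preliminary integrations of the 𝐑 operation —
the seven groups of characteristic functions (1.3)–(1.9), the inductive characteristic functions (1.22)–(1.24),
(1.27), (1.55), (1.75), (1.82), (1.88), the integer `N₀` (p. 179), the boundary-term bookkeeping (1.61)–(1.62),
the fluctuation field (1.53)–(1.54), and the printed bounds (1.32), (1.37)–(1.39), (1.42), (1.45)–(1.47), (1.70),
(1.91), (1.95), p. 193 (extension) and p. 196 (size of `V′`) as typed statement-level leaves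

HONEST FRAMING (lit-balaban cell rule, verbatim): statement-level skeleton of published theorems with citation tags;
proofs where landed; nothing here is a claim about the Yang–Mills mass gap.

CITATION HEADER (lean-in-tree rule 2026-08-18).  T. Bałaban, *Large field renormalization. I. The basic step of the 𝐑
operation*, Commun. Math. Phys. **122**, 175–202 (1989), doi:10.1007/bf01257412, bib `Balaban1989LargeFieldI` (cell paper
B15 = "[IV]" of [Balaban1989LargeFieldII]; its references [I] = [Balaban1987RG1] (B12), [II] = [Balaban1988RG2Cluster] (B13),
[III] = [Balaban1988Convergent] (B14); the numeric references [12], [14], [15], [16] are those of [I]'s list: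
[12] = [Balaban1985Averaging] (CMP 98), [14] = [Balaban1985RegularSpaces] (CMP 99, 75–102), [15] = [Balaban1985Variational]
(CMP 102, 277–309), [16] = [Balaban1985UV3] (CMP 102, 255–275) — read off [I] p. 299).  PDF held:
`paper:balaban1989-cmp122-large-field-i` (journal page = PDF page + 174); every quotation below was READ AS AN IMAGE on the
x2 page renders `run/shared/lean/pub/pub-balaban/b2b-balaban-ref1/pages/1989-cmp122-large-field-I/…-pNNN-x2.png`
(pNNN = PDF page), not on the OCR layer.  The paper is a manuscript under adjudication by the audit cell `pub-balaban`;
NOTHING printed in it is asserted here as a fact: every display enters as a PARAMETERISED `def … : Prop` / `ℝ`-valued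
definition (docstring = quotation + page), and the twelve `theorem`s are elementary bookkeeping (definitional unfoldings,
the decompositions of unity (1.28)/(1.88), a triangle inequality in the gauge group for (1.54), the telescoping sum (1.62))
or real arithmetic of printed one-line inferences (pp. 185, 186, 193, 199), proved without `sorry` and without new axioms.

WHY THIS MODULE (mega-formalization `lit-balaban`, reader/typer r12, Phase 1 = statement-first skeleton).  The tree's
B15 family — `…B15` (𝐑 (0.2)–(0.6), Proposition 1, (1.80)), `…B15.BasicStep` ((0.3)/(0.4)/(1.100)–(1.102) as kernel
identities; leaves (1.24)/(1.49)/(1.51), (1.29), (1.31), (1.43), (1.47)–(1.52), (1.57), (1.64)(i), (1.83), (1.84), (1.87),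
(1.89), (1.94), (1.96), (1.98), (1.101)), `…B15.ComplexSpaces` ((1.64)–(1.69)), `…B15Ineq194Flow` ((1.27) `δ′_j`, (1.94)),
`…B15.Membership195` (p. 195), `…B16Stage3Regions` ((1.10)–(1.12), (1.73)), `…B16StoppingRule` (p. 177 (i), (ii)),
`…B16ComponentForm` ((1.74)), `…T4IndicatorShell` ((1.75) as an indicator) — leaves the displays listed in the title
untyped; `…Balaban1983to89.Setup` says so explicitly for (1.3)–(1.9) ("the seven groups of characteristic functions
(B15 (1.3)–(1.9)) are reader-owned").  This module types them, and nothing already typed is restated: the sibling leaves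
are referred to BY NAME in the docstrings below.  Vocabulary reused from `Setup`: `GaugeGroup` (`dist1 g = |g − 1|`,
`reTr`), `GaugeField`, `Plaq`, `PBond`, `PlaqSmallOn S δ U` (= "`|U(∂p) − 1| < δ` for `p ∈ S`"), `LocExpansion` /
`LocExpansion.ExpDecayBound` (the shape of (1.63)/(1.70)).  Where the printed object is a background-field FUNCTION of the
integration variables (`U_{j,□}(V_j)`, `U^{(n)}_{k,Z}`, `V^{(j)}_Z = M^j(U^{(j+1−h)}_{k,Z})`, `ℍ`-operators of [III]/[12]/[14])
it enters as an explicit argument (a configuration, or a real "size"), exactly as in `…B15.BasicStep` Part B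
(schematic real parameters; the cell's DIVERGENCE row D-b01.3); the operator identities (1.30), (1.34)–(1.36),
(1.40)–(1.41), (1.44), (1.56), (1.58), (1.85)–(1.86), (1.90), (1.92)–(1.93), (1.97) ("the standard representation")
and the integrals (1.2), (1.25), (1.60), (1.71)–(1.72), (1.76), (1.99)–(1.100) are NOT typed here (they are
construction formulas over the machinery of [III] §2–§3; (1.100)/(1.102) are `…B15.BasicStep.normTerm` /
`integral_normTerm_eq`).  Companion inventory: `run/shared/lean/pub/lit-balaban/lit-balaban-r12/SKELETON-r12.md`
(one row per numbered display of the paper, with the tree declaration that types it).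
-/

open scoped BigOperators
open Finset

namespace Literature.MathematicalPhysics.QuantumFieldTheory.Balaban1983to89.B15.PrelimIntegrations

/-! ## Part A. The seven groups of characteristic functions (1.3)–(1.9) (p. 178) and their descendants

p. 178 [PDF 4], verbatim: *"These operations are given by the formula (2.21) [III], in which the functions ζ, χ have
the simplest form, namely by the condition (ii) no large field characteristic functions are included in them. … Thus
ζ(Ω^c_{j+1}∩Z_{j+1})χ(Ω_{j+1}∩Z_{j+1}) is equal to the product of the following seven groups of functions:"* (1.3)–(1.9),
*"The cubes □ in (1.3) are the LM₂R_j-cubes of the partition of the lattice T_{L^{−j}}, or the L^{−(k−j)}LM₂R_j-cubes of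
the lattice T_η, and the cubes □′ in (1.4), (1.7)–(1.9) are the LM₂R_{j+1}-cubes of the partition of the lattice
T_{L^{−(j+1)}}."*  The restricted configuration (`U_{j,□}(V_j, ·)`, `V_j`, `V^{(j)}_□`, `A_j`) is an explicit argument. -/

section CharacteristicFunctions

variable {P : Params} {i : ℕ} {G : Type*} [GaugeGroup G]

/-- **(1.3)/(1.4)** p. 178, verbatim (1.3): *"χ({sup_{p⊂□^∼} |U_{j,□}(V_j, ∂p) − 1| < ε_j(L^{k−j}η)²}) for
□ ⊂ (Ω_j^{∼4}∖Ω^∼_{j+1})∩Z"*; (1.4) is the same display at `j+1`: *"χ({sup_{p⊂□′^∼} |U_{j+1,□′}(V_{j+1}, ∂p) − 1| <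
ε_{j+1}(L^{k−j−1}η)²}) for □′ ⊂ (Ω^{∼4}_{j+1}∖Ω^∼_{j+2})∩Z"*.  Typed as the small-plaquette condition of `Setup` on the
plaquette set `S` (= the plaquettes of `□^∼`) for the background configuration `U` (= `U_{j,□}(V_j)`) at threshold
`ε_j (L^{k−j}η)²` (`Lpow = L^{k−j}`). [cite: Balaban1989LargeFieldI, (1.3)–(1.4) p.178] -/
def SF13 (S : Set (Plaq P i)) (εj Lpow η : ℝ) (U : GaugeField P i G) : Prop :=
  PlaqSmallOn S (εj * (Lpow * η) ^ 2) U

/-- (1.3) is `PlaqSmallOn` at the printed threshold: the display *"sup_{p⊂□^∼} |U_{j,□}(V_j, ∂p) − 1| < ε_j(L^{k−j}η)²"*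
unfolded plaquette by plaquette (definitional). [cite: Balaban1989LargeFieldI, (1.3) p.178] -/
theorem sf13_iff (S : Set (Plaq P i)) (εj Lpow η : ℝ) (U : GaugeField P i G) :
    SF13 S εj Lpow η U ↔ ∀ p ∈ S, dist1 (GaugeField.plaqHol U p) < εj * (Lpow * η) ^ 2 := Iff.rfl

/-- **(1.5)** p. 178, verbatim: *"χ({|V_j(y, x) − 1| < ε_j}) for y ∈ (Ω^{∼3}_{j+1}∖Ω^∼_{j+1})^{(j+1)}∩Z, x ∈ B(y), x ≠ y"*
— smallness of the (contour) bond variables `V_j(y,x)` on the index set `S` of pairs `(y, x)`. [cite: Balaban1989LargeFieldI, (1.5) p.178] -/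
def SF15 {B : Type*} (S : Set B) (εj : ℝ) (V : B → G) : Prop := ∀ b ∈ S, dist1 (V b) < εj

/-- **(1.6)** p. 178, verbatim: *"(1/z) exp[−(1/g_j²)[1 − Re tr V_j(y, x)]] for y ∈ (Ω^{∼3}_{j+1}∖Ω_{j+1})^{(j+1)}∩Z,
x ∈ B(y), x ≠ y"* — the gauge-fixing density of one bond variable (`z` its normalisation; cf. `Setup.expGaugeFixWeight`,
the product form of [I] (0.14)–(0.16)). [cite: Balaban1989LargeFieldI, (1.6) p.178] -/
noncomputable def gfDensity16 (z gj : ℝ) (V : G) : ℝ := z⁻¹ * Real.exp (-(1 / gj ^ 2) * (1 - reTr V))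

/-- **(1.7)/(1.8)** p. 178, verbatim (1.7): *"χ({sup_{b∈(□′^{∼2})^{(k)*}} |V_j(b)(V^{(j)}_□(b))^{−1} − 1| < 2δ_j}) for
□′ ⊂ (Ω^{∼2}_{j+1}∖Ω_{j+1})∩Z"*; (1.8): *"χ({sup_{b∈(□′^{∼2})^{(k)*}} |exp ig_jA_j(b)V^{(j)}_{Z_{j+1}∖Z_j}(b)
(V^{(j)}_□(b))^{−1} − 1| < 2δ_j}) for □′ ⊂ (Ω_{j+1}∖Λ^∼_{j+1})∩Z"* — both are "`|W(b) V^{(j)}_□(b)^{−1} − 1| < 2δ_j` on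
the bond set `S`" for a tested configuration `W` (`V_j`, resp. `exp(ig_jA_j)V^{(j)}_{Z_{j+1}∖Z_j}`) against the
reference `Vref = V^{(j)}_□`. [cite: Balaban1989LargeFieldI, (1.7)–(1.8) p.178] -/
def SF17 {B : Type*} (S : Set B) (δj : ℝ) (W Vref : B → G) : Prop := ∀ b ∈ S, dist1 (W b * (Vref b)⁻¹) < 2 * δj

/-- **(1.9)** p. 178, verbatim: *"χ({sup_{b∈(□′^{∼2})^{(k)*}} |A_j(b)| < g_j^{−1}δ_j}) for □′ ⊂ (Λ^∼_{j+1}∖Λ_{j+1})∩Z"*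
(these are the functions `χ^{(j)}_{□′}` of (1.28)–(1.29)); `A` = the Lie-algebra field, valued in a normed space. [cite: Balaban1989LargeFieldI, (1.9) p.178] -/
def SF19 {B V : Type*} [Norm V] (S : Set B) (gj δj : ℝ) (A : B → V) : Prop := ∀ b ∈ S, ‖A b‖ < gj⁻¹ * δj

/-- **(1.22)** p. 181 [PDF 7], verbatim: *"χ_k^{(0)} = χ({|U^{(0)}_{k,Z}(∂p) − 1| < (1 − β½)ε_h(L^{k−h}η)² for
p ∈ Ω_h∖Ω_{h+1}})"* ("We start with the decomposition of unity 1 = χ_k^{(0)} + (1 − χ_k^{(0)})").  `U` = `U^{(0)}_{k,Z}`,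
`S` = the plaquettes of `Ω_h∖Ω_{h+1}`, `Lpow = L^{k−h}`. [cite: Balaban1989LargeFieldI, (1.22) p.181] -/
def SF122 (S : Set (Plaq P i)) (β εh Lpow η : ℝ) (U : GaugeField P i G) : Prop :=
  PlaqSmallOn S ((1 - β / 2) * εh * (Lpow * η) ^ 2) U

/-- **(1.23)** p. 181, verbatim: *"χ_k^{(1)} = χ({|U^{(1)}_{k,Z}(∂p) − 1| < (1 − β(1/2 + 1/2²))ε_h(L^{k−h}η)² for
p ∈ Z″_{h+1}∩Ω_h, |U^{(1)}_{k,Z}(∂p) − 1| < (1 − β½)ε_{h+1}(L^{k−h−1}η)² for p ∈ Ω^c_{h+2}∖Z″_{h+1}})"* — two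
small-plaquette conditions on the two printed plaquette sets `S₁`, `S₂` (`Lpow = L^{k−h}`). [cite: Balaban1989LargeFieldI, (1.23) p.181] -/
def SF123 (S₁ S₂ : Set (Plaq P i)) (β εh εh1 Lpow L η : ℝ) (U : GaugeField P i G) : Prop :=
  PlaqSmallOn S₁ ((1 - β * (1 / 2 + 1 / 2 ^ 2)) * εh * (Lpow * η) ^ 2) U ∧
    PlaqSmallOn S₂ ((1 - β / 2) * εh1 * (Lpow / L * η) ^ 2) U

/-- **(1.24)**, last line, p. 182 [PDF 8], verbatim: *"|U^{(n)}_{k,Z}(∂p) − 1| < c(1 − β½)ε_j(L^{k−j}η)² for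
p ∈ Ω_{j−1}∖Ω_{j+1}"*, *"where c = 1 for j < k, and c = 3 for j = k. We choose the number β satisfying 0 < β ≦ 1/2,
but not too small, e.g., we can take β = 1/2. The number L₀ satisfies 2 ≦ L₀ < 1/2L, e.g., we can take
L₀ = (1/2)(L − 1)."*  The other lines of (1.24) are the leaves `…B15.BasicStep.SF149` (the `Z″_{i+1}∖Z″_i` lines, as
rewritten in (1.49)) and `…B15.BasicStep.SF151` (the `L₀`-weighted `(1 − β½)` lines, as rewritten in (1.51)); this is
the top line with its factor `c` (`εE = ε_j(L^{k−j}η)²`). [cite: Balaban1989LargeFieldI, (1.24) p.182] -/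
def SF124c (dev c β εE : ℝ) : Prop := dev < c * (1 - β / 2) * εE

/-- The printed value of `c` in (1.24): `c = 1` for `j < k`, `c = 3` for `j = k` (p. 182; the same rule in (1.68),
`…B15.ComplexSpaces.cConst`). [cite: Balaban1989LargeFieldI, (1.24) p.182] -/
noncomputable def cTop (j k : ℕ) : ℝ := if j < k then 1 else 3

/-- **(1.27)** p. 182, verbatim: *"χ′_j = χ({|V_j(b)(V^{(j)}_Z(b))^{−1} − 1| < 2δ′_j for b ∈ (Ω^c_{j+1}∖Z″_{j+1})^{(j)*}})"*,
with (p. 183) *"δ′_j = g_jA₁p₁(g_j), p₁(g_j) = (log g_j^{−2})^{p₁}, and p₁ < p₀"* (`δ′_j` along a flow is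
`…B15Ineq194Flow.deltaPrimeK`); `Vz` = `V^{(j)}_Z` of (1.26). Same shape as (1.7) with `δ′_j`. [cite: Balaban1989LargeFieldI, (1.27) p.182] -/
def SF127 {B : Type*} (S : Set B) (δ'j : ℝ) (Vj Vz : B → G) : Prop := ∀ b ∈ S, dist1 (Vj b * (Vz b)⁻¹) < 2 * δ'j

/-- **(1.28)** p. 183 [PDF 9], verbatim: *"1 = Π_{□′⊂Ω_{j+1}∖Ω^{∼−1}_{j+1}} χ^{(j)}_{□′} + (1 − Π_{□′⊂Ω_{j+1}∖Ω^{∼−1}_{j+1}}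
χ^{(j)}_{□′})"* — the decomposition of unity completing the (1.9)-functions to `Z_{j+1}∩Ω_{j+1}`; an identity of real
numbers for any finite family of factors `χ`. [cite: Balaban1989LargeFieldI, (1.28) p.183] -/
theorem decomp128 {ι : Type*} (s : Finset ι) (χ : ι → ℝ) :
    (∏ b ∈ s, χ b) + (1 - ∏ b ∈ s, χ b) = 1 := by ring

/-- **(1.55)** p. 188 [PDF 14], verbatim: *"χ′^{(j)} = χ({|B_j(b)| < δ′_j for b ∈ (Ω^c_{j+1}∖Z″_{j+1})^{(j)*}})"* — the
restriction on the rescaled fluctuation variable `B_j` (after `B′_j = g_jB_j`, p. 187). [cite: Balaban1989LargeFieldI, (1.55) p.188] -/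
def SF155 {B V : Type*} [Norm V] (S : Set B) (δ'j : ℝ) (Bj : B → V) : Prop := ∀ b ∈ S, ‖Bj b‖ < δ'j

/-- **(1.59)** p. 188, verbatim: *"χ({|exp ig_jB_j(b) − 1| < 2δ′_j for b ∈ (Ω^c_{j+1}∖Z″_{j+1})^{(j)*}})(1 − χ′^{(j)})"* —
the function `χ′_j(1 − χ′^{(j)})` after the change of variables (1.22) [III], *"it does not depend at all on the background
fields"*; `E b` = the group element `exp ig_jB_j(b)`. [cite: Balaban1989LargeFieldI, (1.59) p.188] -/
def SF159 {B : Type*} (S : Set B) (δ'j : ℝ) (E : B → G) : Prop := ∀ b ∈ S, dist1 (E b) < 2 * δ'j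

/-- **(1.75)** p. 193 [PDF 19], verbatim: *"χ_{k,Λ} = χ({inf_{V_k↾_Λ} sup_{p∈Ω^c_k} |U_{k,Z}(∂p) − 1| < 2ε_kη²})"*, with
*"The restriction introduced by this function is on the field V_k↾_{Z∩Λ^c} only. It means that this field has an
extension on the whole domain Z, such that the extended field satisfies the regularity condition in (1.75)."*  Typed in
the second (existential) form: `Ext` = the extensions `V_k↾_Λ` of the given boundary field, `dev e p` =
`|U_{k,Z}(∂p) − 1|` for the extended field `e` ((1.74), `…B16ComponentForm`), `S` = the printed plaquette range.  (The
indicator form `1[θ ≤ u]` of `1 − χ_{k,Λ}` is `…T4IndicatorShell.largeInd`.) [cite: Balaban1989LargeFieldI, (1.75) p.193] -/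
def Chi175 {Ext Pl : Type*} (dev : Ext → Pl → ℝ) (S : Set Pl) (εk η : ℝ) : Prop :=
  ∃ e : Ext, ∀ p ∈ S, dev e p < 2 * εk * η ^ 2

/-- **(1.82)** p. 196 [PDF 22], verbatim: *"χ′ = χ({|B′(b)| < δ′_k for b ∈ 𝔹₀}), and V′ = exp iB′"* (the fluctuation
field of (1.81) on `𝔹₀ = 𝔹″_k∩Λ₀`, after the tree gauge `δ_{T₀}(V′)`). [cite: Balaban1989LargeFieldI, (1.82) p.196] -/
def SF182 {B V : Type*} [Norm V] (B0 : Set B) (δ'k : ℝ) (B' : B → V) : Prop := ∀ b ∈ B0, ‖B' b‖ < δ'k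

/-- **(1.88)** p. 197 [PDF 23], the half-threshold functions, verbatim: *"χ({sup_{p⊂□^∼} |U_{h,□}((1, V_h), ∂p) − 1| <
½ε_h(L^{k−h}η)²})"* (and the complementary `≧ ½ε_h(L^{k−h}η)²`), *"= Σ_P χ_{h,1/2}(P^c)χ^c_{h,1/2}(P)"*; p. 198: *"The
symbol (1, V_h) means the configuration (1↾_{Ω″^{∼2}_{h+1}}, V_h↾_{(Ω″^{∼2}_{h+1})^c})"*.  `U` = `U_{h,□}((1, V_h))`,
`S` = the plaquettes of `□^∼`, `Lpow = L^{k−h}`. [cite: Balaban1989LargeFieldI, (1.88) p.197] -/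
def SFhalf188 (S : Set (Plaq P i)) (εh Lpow η : ℝ) (U : GaugeField P i G) : Prop :=
  PlaqSmallOn S (1 / 2 * εh * (Lpow * η) ^ 2) U

/-- **(1.88)** p. 197, the decomposition of unity, verbatim: *"1 = Σ_P Π_{□⊂P^c} χ({sup_{p⊂□^∼} |U_{h,□}((1, V_h), ∂p) − 1|
< ½ε_h(L^{k−h}η)²}) · Π_{□⊂P} χ({sup_{p⊂□^∼} |U_{h,□}((1, V_h), ∂p) − 1| ≧ ½ε_h(L^{k−h}η)²}) = Σ_P χ_{h,1/2}(P^c)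
χ^c_{h,1/2}(P)"*, *"The summation above is over subsets P of a component of the domain (Ω″^∼_{h+1})^c∩Ω_h, which are
unions of LM₂R_h-cubes"* — for `{0,1}`-valued (indeed any real) cube factors `χ □` with complementary factor `1 − χ □`,
an identity over the finite set `s` of cubes (`Finset.prod_add`). [cite: Balaban1989LargeFieldI, (1.88) p.197] -/
theorem decomp188 {ι : Type*} [DecidableEq ι] (s : Finset ι) (χ : ι → ℝ) :
    ∑ Pset ∈ s.powerset, (∏ b ∈ s \ Pset, χ b) * ∏ b ∈ Pset, (1 - χ b) = 1 := by
  have h := Finset.prod_add (fun b => 1 - χ b) χ s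
  simp only [sub_add_cancel, Finset.prod_const_one] at h
  calc ∑ Pset ∈ s.powerset, (∏ b ∈ s \ Pset, χ b) * ∏ b ∈ Pset, (1 - χ b)
      = ∑ t ∈ s.powerset, (∏ b ∈ t, (1 - χ b)) * ∏ b ∈ s \ t, χ b :=
        Finset.sum_congr rfl fun _ _ => mul_comm _ _
    _ = 1 := h.symm

end CharacteristicFunctions

/-! ## Part B. The integers `N₀`, `k₀` (pp. 179, 181), the boundary terms (1.61)–(1.62), the fluctuation field (1.53) -/

section Bookkeeping

/-- **`N₀`**, p. 179 [PDF 5], verbatim: *"Take the smallest positive integer N₀ such, that L^{−N₀+1}MR_{k−N₀+1} = M. It is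
easy to see that either there is exactly one such integer, or there are two. We assume that N > N₀, in fact it will
become clear later that N is much greater than N₀."*; p. 192: *"This number is defined by the equality
L^{−N₀+1}R_{k−N₀+1} = 1, from which we get L^{N₀−1} = R_{k−N₀+1} ≦ (L + 1)(N₀ + 1)^{β₀}R_k."*  `R : ℕ → ℝ` = the
scales `R_j` of [III] (2.5); standing range `N₀ ≤ k`. [cite: Balaban1989LargeFieldI, p.179 (definition of N₀)] -/
def IsN0 (L : ℝ) (R : ℕ → ℝ) (k N₀ : ℕ) : Prop :=
  0 < N₀ ∧ R (k - N₀ + 1) = L ^ (N₀ - 1) ∧ ∀ N', 0 < N' → N' < N₀ → R (k - N' + 1) ≠ L ^ (N' - 1)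

/-- **`k₀ = k − N₀`**, p. 181 [PDF 7], verbatim: *"it has a different form for j = h + n ≦ k₀ = k − N₀, and for j > k₀"*.
[cite: Balaban1989LargeFieldI, p.181 (definition of k₀)] -/
def k0 (k N₀ : ℕ) : ℕ := k - N₀

/-- **(1.61)** p. 189 [PDF 15], verbatim: *"𝔹_k^{(n)} = Σ_{i=1}^{n} ℂ_k^{(i)}, where ℂ_k^{(i)} is the one-step contribution,
i.e., the contribution from the i-th integration."* (the new boundary terms of the effective action after `n`
preliminary integrations; `C i` valued in any additive commutative monoid of action functionals). [cite: Balaban1989LargeFieldI, (1.61) p.189] -/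
def bdryTerms {R : Type*} [AddCommMonoid R] (C : ℕ → R) (n : ℕ) : R := ∑ i ∈ Finset.Icc 1 n, C i

/-- **(1.62)**, second member, p. 189, verbatim: *"𝔹_k^{(n+1)} = 𝔹_k^{(n)} + ℂ_k^{(n+1)}"* — PROVED from (1.61).  (The first
member, *"ℂ_k^{(n+1)} = log(the ∫ in (1.60)) + A((g_k^{(n+1)}(·))^{−2} − (g_k^{(n)}(·))^{−2}, U_k^{(n+1)})"*, defines
`ℂ_k^{(n+1)}` and is not typed.) [cite: Balaban1989LargeFieldI, (1.62) p.189] -/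
theorem bdryTerms_succ {R : Type*} [AddCommMonoid R] (C : ℕ → R) (n : ℕ) :
    bdryTerms C (n + 1) = bdryTerms C n + C (n + 1) := by
  unfold bdryTerms
  exact Finset.sum_Icc_succ_top (by omega) C

variable {G : Type*} [GaugeGroup G]

/-- **(1.53)** p. 187 [PDF 13], verbatim: *"We introduce the fluctuation field V′_j on (Ω^c_{j+1}∖Z″_j)^{(j)},
V′_j = V_j(V^{(j)})^{−1}, V^{(j)} = M^j(U_k^{(n+1)}), B′_j = (1/i) log V′_j."* — the bondwise quotient of the integration
variable by the background average (`Vbg = V^{(j)}`). [cite: Balaban1989LargeFieldI, (1.53) p.187] -/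
def fluct153 {B : Type*} (Vj Vbg : B → G) : B → G := fun b => Vj b * (Vbg b)⁻¹

/-- **(1.54)** p. 187, verbatim: *"This field is small, because |V′_j − 1| ≦ |V_j(V^{(j)}_Z)^{−1} − 1| + |V^{(j)}_Z(V^{(j)})^{−1}
− 1| < 3δ′_j, by (1.27), and by the fact that the second expression on the right-hand side is much smaller than δ′_j.
This we will show later. Thus B′_j is small, |B′_j| < 6δ′_j"*.  The first (triangle) step, PROVED in any `GaugeGroup`
from `|gh − 1| ≤ |g − 1| + |h − 1|` (`Setup.GaugeGroup.dist1_mul_le`). [cite: Balaban1989LargeFieldI, (1.54) p.187] -/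
theorem dist1_fluct_le (Vj Vz Vbg : G) :
    dist1 (Vj * Vbg⁻¹) ≤ dist1 (Vj * Vz⁻¹) + dist1 (Vz * Vbg⁻¹) := by
  have h : Vj * Vbg⁻¹ = Vj * Vz⁻¹ * (Vz * Vbg⁻¹) := by rw [mul_assoc, inv_mul_cancel_left]
  rw [h]
  exact GaugeGroup.dist1_mul_le _ _

/-- (1.54), the conclusion `|V′_j(b) − 1| < 3δ′_j` from the two printed inputs: (1.27) `|V_j(V^{(j)}_Z)^{−1} − 1| < 2δ′_j`
and the deferred *"much smaller than δ′_j"* (here: `< δ′_j`). [cite: Balaban1989LargeFieldI, (1.54) p.187] -/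
theorem ineq154 {Vj Vz Vbg : G} {δ' : ℝ} (h127 : dist1 (Vj * Vz⁻¹) < 2 * δ') (hsmall : dist1 (Vz * Vbg⁻¹) < δ') :
    dist1 (Vj * Vbg⁻¹) < 3 * δ' := by
  have := dist1_fluct_le Vj Vz Vbg
  linarith

/-- **(1.81)** p. 195 [PDF 21], verbatim: *"We put V″ = V′V₀ on Λ₀, V₀ = M_{𝔹″_k}(U₀). (1.81) More precisely the equality is
on the set 𝔹₀ = 𝔹″_k∩Λ₀."* — the fluctuation variable `V′ = V″V₀^{−1}` around the background average `V₀` is the same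
bondwise quotient as (1.53). [cite: Balaban1989LargeFieldI, (1.81) p.195] -/
theorem fluct181_eq {B : Type*} (V'' V₀ : B → G) (b : B) : fluct153 V'' V₀ b * V₀ b = V'' b := by
  simp [fluct153]

end Bookkeeping

/-! ## Part C. The printed bounds of the proof of (1.29) (pp. 184–187) and of pp. 188–199 (schematic reals)

As in `…B15.BasicStep` Part B: `dev`-letters are the printed deviations `|⋯ − 1|`, sizes of `ℍ`-functions are reals,
`O(1)` is an explicit constant `C`. -/

section Bounds

/-- **(1.32)** p. 184 [PDF 10], verbatim: *"notice that the restrictions introduced by the functions χ^{(j)}_{□′} in (1.29)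
imply the bound |exp ig_jA_j(b)V^{(j)}_{Z_{j+1}∖Z_j}(b)(V^{(j)}_{□′}(b))^{−1} − 1| < δ_j + |V^{(j)}_{Z_{j+1}∖Z_j}(b) −
V^{(j)}_{□′}(b)|"* (`dev8` = the left side, the quantity tested in (1.8); `diff` = the printed difference). [cite: Balaban1989LargeFieldI, (1.32) p.184] -/
def Ineq132 (dev8 δj diff : ℝ) : Prop := dev8 < δj + diff

/-- **(1.37)** p. 184, verbatim: *"From the equalities and bounds (106)–(108), (159)–(163) in [12] we obtain
|exp iℍ^{(j)}(b) − 1| ≦ O(1)L · sup_{B^j(b₋)∪B^j(b₊)} |ℍ|"* ([12] = [Balaban1985Averaging]; `supH` = the printed sup,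
`C` = the `O(1)`). [cite: Balaban1989LargeFieldI, (1.37) p.184] -/
def Ineq137 (dev C L supH : ℝ) : Prop := dev ≤ C * L * supH

/-- **(1.38)** p. 185 [PDF 11], verbatim: *"|ℍ| < B₃(4δ′_j + exp(−δMR_{j+1})22d²ε_{j+1} + exp(−δ6LMR_{j+1})22d²ε_j)
≦ B₃(4δ′_j + exp(−δMR_{j+1})44d²(1 + β₀)ε_j) = B₃(4p₁(g_j)/p₀(g_j) + exp(−δMR_{j+1})44d²(1 + β₀)A₀/A₁)δ_j on □′^{∼2},
for □′ ⊂ Ω^∼_{j+1}∖Λ^∼_{j+1}"* (inputs: the field in `ℍ` vanishes off boundary layers of width `2LM₁`/`2M₁` where it is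
`≤ 22d²ε_{j+1}`, `≤ 22d²ε_j`, and is `≤ 4δ′_j` on `Ω^c_j∩Z^c_j` by (1.27); the exponential decay of `ℍ` with rate `δ` —
(1.65) of [14] = [Balaban1985RegularSpaces]).  Typed: the first printed inequality (`R = R_{j+1}`). [cite: Balaban1989LargeFieldI, (1.38) p.185] -/
def Ineq138 (H B₃ δ'j δ M R L d εj εj1 : ℝ) : Prop :=
  H < B₃ * (4 * δ'j + Real.exp (-(δ * M * R)) * (22 * d ^ 2) * εj1
    + Real.exp (-(δ * 6 * L * M * R)) * (22 * d ^ 2) * εj)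

/-- **(1.39)** p. 185, verbatim: *"We assume that it [γ] is so small that the expression on the left-hand side of (1.37)
can be bounded by 1/2δ_j. From this we obtain |V^{(j)}_{Z_{j+1}∖Z_j}(b) − V^{(j)}_{□′}(b)| < ½δ_j + |V^{(j)}_{□′}(b) −
V^{(j)}_Z(b)|"*. [cite: Balaban1989LargeFieldI, (1.39) p.185] -/
def Ineq139 (diff δj diff' : ℝ) : Prop := diff < δj / 2 + diff'

/-- **(1.42)** p. 185, verbatim: *"|V^{(j)}_{□′}(b) − V^{(j)}_Z(b)| = |exp iℍ^{(j)}_{□′}(b) − 1| < O(1)B₃exp(−δLM₂R_{j+1})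
22d²(1 + β₀)(A₀/A₁)δ_j ≦ ½δ_j on □′^{∼2}"*, whence *"The inequalities (1.32), (1.39), and (1.42) imply that the
functions (1.8) in the product in (1.29) are equal to 1."* (`C` = the `O(1)`, `R = R_{j+1}`). [cite: Balaban1989LargeFieldI, (1.42) p.185] -/
def Ineq142 (diff' C B₃ δ L M₂ R d β₀ A₀ A₁ δj : ℝ) : Prop :=
  diff' < C * B₃ * Real.exp (-(δ * L * M₂ * R)) * (22 * d ^ 2) * (1 + β₀) * (A₀ / A₁) * δj ∧
    C * B₃ * Real.exp (-(δ * L * M₂ * R)) * (22 * d ^ 2) * (1 + β₀) * (A₀ / A₁) * δj ≤ δj / 2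

/-- The mechanism of p. 185 for the functions (1.8): (1.32), (1.39), (1.42) and the smallness `½δ_j`-assumption of
p. 185 give `dev8 < 2δ_j`, i.e. the (1.8)-function equals 1 — elementary, PROVED. [cite: Balaban1989LargeFieldI, (1.42) p.185] -/
theorem sf18_of_132_139_142 {dev8 δj diff diff' : ℝ} (h132 : Ineq132 dev8 δj diff) (h139 : Ineq139 diff δj diff')
    (h142 : diff' < δj / 2) : dev8 < 2 * δj := by
  unfold Ineq132 at h132
  unfold Ineq139 at h139
  linarith

/-- **(1.45)** p. 186 [PDF 12], verbatim: *"sup_{B^i(y)} L^iη|ℍ^{(n)}_{k,Z}|, sup_{B^i(y)} (L^iη)²|∇^η_{U^{(n+1)}_k}ℍ^{(n)}_{k,Z}|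
≦ B₃exp(−δd(y, Ω^c_{j+1}∖Z″_{j+1}))4δ′_j. (1.45) Here d(·,·) is the scaled distance, y is a point of the i-th component of
the determining set 𝔹_k^{(n)}."* (`sH`, `sDH` = the two printed sups; `dist` = `d(y, Ω^c_{j+1}∖Z″_{j+1})`). [cite: Balaban1989LargeFieldI, (1.45) p.186] -/
def Ineq145 (sH sDH B₃ δ dist δ'j : ℝ) : Prop :=
  sH ≤ B₃ * Real.exp (-(δ * dist)) * (4 * δ'j) ∧ sDH ≤ B₃ * Real.exp (-(δ * dist)) * (4 * δ'j)

/-- **(1.46)** p. 186, the second printed inequality, verbatim: *"|U^{(n)}_{k,Z}(∂p) − 1| ≦ … ≦ |U^{(n+1)}_{k,Z}(∂p) − 1|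
(1 + 8B₃L^{−i}exp(−δd(y, Ω^c_{j+1}∖Z″_{j+1}))δ′_j) + 9B₃(A₁p₁(g_j))/(A₀p₀(g_j))(1 + β₀)(1 + (j − i)^{1/2})
exp(−δd(y, Ω^c_{j+1}∖Z″_{j+1}))ε_i(L^{k−i}η)² for p∈B^i(y), where y∈(Z″_{i+1}∖Z″_i)^{(i)} = Γ″_i for i = j − 1, j − 2, …,
and y∈(Ω^c_{j+1}∖Z″_j)^{(j)} for i = j."* (`Linv = L^{−i}`, `ratio = (A₁p₁(g_j))/(A₀p₀(g_j))`, `gap = j − i`,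
`εE = ε_i(L^{k−i}η)²`). [cite: Balaban1989LargeFieldI, (1.46) p.186] -/
def Ineq146 (dev dev' B₃ Linv δ dist δ'j ratio β₀ gap εE : ℝ) : Prop :=
  dev ≤ dev' * (1 + 8 * B₃ * Linv * Real.exp (-(δ * dist)) * δ'j)
    + 9 * B₃ * ratio * (1 + β₀) * (1 + gap ^ (1 / 2 : ℝ)) * Real.exp (-(δ * dist)) * εE

/-- **(1.47)** p. 186, verbatim: *"Thus, by the definition of the domains Z″_i, we obtain exp(−δd(y, Ω^c_{j+1}∖Z″_{j+1})) ≦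
exp(−δ(M/M₁)(j − i)) for y∈Γ″_i, i < j."*, followed by *"We choose M large enough, so that δ(M/M₁) ≧ 2."* (`gap = j − i`).
The arithmetic continuation to (1.48) is `…B15.BasicStep.Ineq148`. [cite: Balaban1989LargeFieldI, (1.47) p.186] -/
def Ineq147 (δ dist M M₁ gap : ℝ) : Prop := Real.exp (-(δ * dist)) ≤ Real.exp (-(δ * (M / M₁) * gap))

/-- (1.47) holds as soon as the scaled distance dominates, `δ·d ≥ δ(M/M₁)(j−i)` — the monotonicity of `exp`, PROVED; the
geometric input "`d(y, Ω^c_{j+1}∖Z″_{j+1}) ≥ (M/M₁)(j − i)` for `y ∈ Γ″_i`" is the content of *"by the definition of the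
domains Z″_i"*. [cite: Balaban1989LargeFieldI, (1.47) p.186] -/
theorem ineq147_of_dist {δ dist M M₁ gap : ℝ} (h : δ * (M / M₁) * gap ≤ δ * dist) : Ineq147 δ dist M M₁ gap := by
  unfold Ineq147
  exact Real.exp_le_exp.mpr (by linarith)

/-- **(1.70)** p. 192 [PDF 18], verbatim: *"Let us formulate the bounds for ℂ_k^{(n)}. It has the representation (1.63), with
n instead of n + 1, and each term ℂ_k^{(n)}(X, U_k^{(n)}) can be extended to an analytic function defined on the space
Ũ^{(n)c}_k(X, α̃₀, α̃₁) and satisfying the bound |ℂ_k^{(n)}(X, (𝕌, 𝕁))| ≦ C₀exp(−(1 + 3β)κd_m(X)) (1.70) for X∈𝔻_m in the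
representation (1.63)."*  Typed through `Setup.LocExpansion.ExpDecayBound`: the localized expansion `ℰ` of (1.63) (its
domain system carrying `d_m(X)` for `X ∈ 𝔻_m`), the analyticity domain `𝒰` (= the configurations `(𝕌, 𝕁)` of the spaces
(1.64)–(1.69), `…B15.ComplexSpaces`), prefactor `C₀`, rate `(1 + 3β)κ`. [cite: Balaban1989LargeFieldI, (1.70) p.192] -/
def Ineq170 {Φ : Type*} (ℰ : LocExpansion Φ) (𝒰 : Set Φ) (C₀ β κ : ℝ) : Prop :=
  ℰ.ExpDecayBound 𝒰 C₀ ((1 + 3 * β) * κ)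

/-- (1.70) unfolded: `|ℂ(X, φ)| ≤ C₀ exp(−(1+3β)κ d(X))` on `𝒰` (definitional). [cite: Balaban1989LargeFieldI, (1.70) p.192] -/
theorem ineq170_iff {Φ : Type*} (ℰ : LocExpansion Φ) (𝒰 : Set Φ) (C₀ β κ : ℝ) :
    Ineq170 ℰ 𝒰 C₀ β κ ↔ ∀ X φ, φ ∈ 𝒰 → ‖ℰ.E X φ‖ ≤ C₀ * Real.exp (-((1 + 3 * β) * κ) * ℰ.sys.dj X) := Iff.rfl

/-- **(1.91)** p. 198 [PDF 24], verbatim: *"The function ℍ_{h,□} and it[s] derivatives can be bounded on □^∼ by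
B₃exp(−δ2LM₂R_h)11d²ε_h < 11d²B₃exp(−R_h)ε_h < αε_h, where α is a small, absolute constant, which will be fixed later.
Estimating as in (1.46) we get |U″_{k,Z}(∂p) − 1| < |U_{h,□}(V″, ∂p) − 1|(1 + L^{−h}αε_h) + (α + 8α²ε_h)ε_h(L^{k−h}η)²
for p ⊂ □^∼."* (`Linv = L^{−h}`, `εE = ε_h(L^{k−h}η)²`; p. 199: *"We have chosen α = 1/12 in (1.91), (1.94), (1.95)"*). [cite: Balaban1989LargeFieldI, (1.91) p.198] -/
def Ineq191 (dev devV'' α Linv εh εE : ℝ) : Prop :=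
  dev < devV'' * (1 + Linv * α * εh) + (α + 8 * α ^ 2 * εh) * εE

/-- **(1.95)** p. 199 [PDF 25], verbatim: *"|U_{h,□}(V″, ∂p) − 1| < |U_{h,□}((1, V_h), ∂p) − 1|(1 + L^{−h}αε_h) +
(α + 8α²2ε_h)ε_h(L^{k−h}η)² < ½(1 + L^{−h}αε_h)ε_h(L^{k−h}η)² + (α + 8α²ε_h)ε_h(L^{k−h}η)²."* [sic: `8α²2ε_h` in the
first line, `8α²ε_h` in the second] — the second step uses the half-threshold function `χ_{h,1/2}` of (1.88).  Typed: the
first printed inequality (`dev1 = |U_{h,□}((1, V_h), ∂p) − 1|`). [cite: Balaban1989LargeFieldI, (1.95) p.199] -/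
def Ineq195 (devV'' dev1 α Linv εh εE : ℝ) : Prop :=
  devV'' < dev1 * (1 + Linv * α * εh) + (α + 8 * α ^ 2 * 2 * εh) * εE

/-- (1.95), second step: under `χ_{h,1/2}` (`dev1 < ½εE`, with `0 ≤ 1 + L^{−h}αε_h`) the first line gives the second.
PROVED (monotonicity).  The continuation to (1.96) `< ¾ε_h(L^{k−h}η)²` is `…B15.BasicStep.Ineq196`/`coeff196`. [cite: Balaban1989LargeFieldI, (1.95) p.199] -/
theorem ineq195_half {devV'' dev1 α Linv εh εE : ℝ} (h : Ineq195 devV'' dev1 α Linv εh εE)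
    (hhalf : dev1 < 1 / 2 * εE) (hpos : 0 ≤ 1 + Linv * α * εh) :
    devV'' < 1 / 2 * εE * (1 + Linv * α * εh) + (α + 8 * α ^ 2 * 2 * εh) * εE := by
  unfold Ineq195 at h
  have := mul_le_mul_of_nonneg_right hhalf.le hpos
  linarith

variable {P : Params} {k : ℕ} {G : Type*} [GaugeGroup G]

/-- **p. 193 [PDF 19], the extension of a regular boundary configuration**, verbatim: *"Take a configuration V_k defined
on Z∩Λ^c and satisfying the regularity condition |V_k(∂p′) − 1| < ε for p′ ⊂ Z∩Λ^c, ε > 0 is sufficiently small. There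
are many ways of extending it to the domain Λ. The way we describe here depends only on V restricted to ∂⁺Λ = {y∈Λ^c:
there exists a nearest neighbor point y′∈Λ, or ⟨y, y′⟩∈Λ}. Introduce a generalized axial gauge on the surface ∂⁺Λ. The
configuration V_k↾_{∂⁺Λ} is transformed into a small configuration V′_k, |V′_k(b′) − 1| < O(1)M²ε for b′ ⊂ ∂⁺Λ. We extend
it putting V′_k(b′) = 1 for b′∈Λ. The extended configuration satisfies the regularity condition |V′_k(∂p′) − 1| < O(1)M²ε
for p′ ⊂ Λ∪∂⁺Λ. Now we apply the inverse gauge transformation on ∂⁺Λ, and we get a configuration V_k defined on the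
whole domain, equal to the given one on Z∩Λ^c, and satisfying the regularity condition |∂V_k − 1| < O(1)M²ε."*  Typed
over `Setup.GaugeField`: the given field lives on the bond set `outB` (bonds of `Z∩Λ^c`), regularity is tested on the
plaquette sets `outP` (`p′ ⊂ Z∩Λ^c`) and `allP` (all plaquettes of `Z`), `C` = the `O(1)`, `M` the cube size; `ε` is a
parameter (the print: "sufficiently small"). [cite: Balaban1989LargeFieldI, p.193 (extension of V_k to Λ)] -/
def Extension193 (outB : Set (PBond P k)) (outP allP : Set (Plaq P k)) (C M ε : ℝ) : Prop :=
  ∀ V : GaugeField P k G, PlaqSmallOn outP ε V →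
    ∃ V' : GaugeField P k G, (∀ b ∈ outB, V' b = V b) ∧ PlaqSmallOn allP (C * M ^ 2 * ε) V'

/-- p. 193, the two printed consequences for `U_{k,Z}` (1.74), verbatim: *"The corresponding configuration U_{k,Z}
satisfies the condition |∂U_{k,Z} − 1| < O(1)B₃M²εη²."* and, for a field in the support of `1 − χ_{k,Λ}` with
`ε = sup_{p′⊂Z∩Λ^c}|V_k(∂p′) − 1|`: *"for any extension we have |∂U_{k,Z} − 1| ≧ 2ε_kη², hence 2ε_k < O(1)B₃M²ε, and
|V_k(∂p′) − 1| > (O(1)B₃M²)^{−1}ε_k for some p′ ⊂ Z∩Λ^c. This condition is enough to get the exponential small factor"*.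
The arithmetic of the second sentence, PROVED (`C` = the `O(1)`, `X = O(1)B₃M²`). [cite: Balaban1989LargeFieldI, p.193 (mechanism of 1 − χ_{k,Λ})] -/
theorem largeField193 {εk η ε C B₃ M devU : ℝ} (hη : 0 < η) (hεk : 0 ≤ εk) (hX : 0 < C * B₃ * M ^ 2)
    (hup : devU < C * B₃ * M ^ 2 * ε * η ^ 2) (hlow : 2 * εk * η ^ 2 ≤ devU) :
    (C * B₃ * M ^ 2)⁻¹ * εk < ε := by
  have hη2 : 0 < η ^ 2 := by positivity
  have h1 : 2 * εk * η ^ 2 < C * B₃ * M ^ 2 * ε * η ^ 2 := lt_of_le_of_lt hlow hup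
  have h2 : 2 * εk < C * B₃ * M ^ 2 * ε := lt_of_mul_lt_mul_right h1 hη2.le
  have h3 : εk < ε * (C * B₃ * M ^ 2) := by nlinarith
  have h4 : εk / (C * B₃ * M ^ 2) < ε := (div_lt_iff₀ hX).mpr h3
  simpa [div_eq_inv_mul] using h4

/-- **p. 196 [PDF 22], the size of the fluctuation field after the tree gauge**, verbatim: *"The regularity conditions for
V″, V₀, and the gauge fixing for V′ introduce restrictions on this field. We can prove that it satisfies |V′ − 1| <
O(1)M²NR_k⁴ε_k on 𝔹₀."* (stated without proof; `C` = the `O(1)`, `N` the number of remembered steps, `R_k` the scale of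
[III] (2.5)); `dev = |V′(b) − 1|` for `b ∈ 𝔹₀`. [cite: Balaban1989LargeFieldI, p.196 (bound on V′)] -/
def IneqV196 (dev C M N Rk εk : ℝ) : Prop := dev < C * M ^ 2 * N * Rk ^ 4 * εk

end Bounds

end Literature.MathematicalPhysics.QuantumFieldTheory.Balaban1983to89.B15.PrelimIntegrations
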